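import Literature.Computability.AlgebraicComplexity.TableauEvalKeyWalkPolar
import Mathlib.Data.List.Perm.Basic
import HarnessLib

/-!
# The bit-set label-major programme computes `evalC` (proofs for `TableauEvalKeyWalk.lean`, part 2)

Lean checker of the GCT multiplicity-obstruction engine (cells `pub-gct` / `pub-gct-max`; honest framing: multiplicity-
obstruction search for permanent versus determinant at small `(n, m)`; det-side certificates are LOWER bounds
`r ≤ mult` = negative census; no claim about VP ≠ VNP or P ≠ NP). `evalB` carries the states of the label-major walk as
ONE natural number (bit `i·V + v` ⇔ variable `v` of column `i` unused) and walks a label only through its active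
columns; this file proves `evalB = evalC` by SIMULATION against the list-state programme of
`TableauEvalLabelMajor.lean`, reusing its chain (`sum_walkA`, `resid_of_mem_walkL`, `msortK_perm`, `specL_eq_evalC`,
`symEntry_eq_S`) verbatim: §1 `decode` and the bit bookkeeping (`decode_eq_of_testBit`, `decode_xor_succ`,
`unusedVars_xor`); §2 `walkB_sim` (`choices_sim` for one active column); §3 the layer invariant (`sum_compressB`,
`layerSpecB_stepB`, `layerSum_layersB`), the chunking interface `layersB_append`, `decode_initKey`, `evalB_eq_specL`,
`evalB_eq_evalC`. Elementary [folklore] bookkeeping around [DorflerIkenmeyerPanova2020, §5].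
-/

namespace Literature.Computability.AlgebraicComplexity

namespace TableauEval

/-! ## §1 Bit-set states decode to the list states of `walkA` -/

section Decode

/-- The list state encoded by `key`: for the columns `cs` from index `i` on, the unused variables
of each. [folklore] -/
def decode (V key : ℕ) : List Column → ℕ → List (List ℕ)
  | [], _ => []
  | c :: cs, i => unusedVars V key i c.vars :: decode V key cs (i + 1)

/-- `decode` has one state per column. [folklore] -/
private theorem length_decode (V key : ℕ) : ∀ (cs : List Column) (i : ℕ), (decode V key cs i).length = cs.length
  | [], _ => rfl
  | c :: cs, i => by rw [decode, List.length_cons, length_decode V key cs (i + 1), List.length_cons]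

/-- States only read the bits from `i·V` on. [folklore] -/
private theorem decode_eq_of_testBit (V : ℕ) {key₁ key₂ : ℕ} : ∀ (cs : List Column) (i : ℕ),
    (∀ c ∈ cs, ∀ v ∈ c.vars, v < V) → (∀ b, i * V ≤ b → key₁.testBit b = key₂.testBit b) →
    decode V key₁ cs i = decode V key₂ cs i
  | [], _, _, _ => rfl
  | c :: cs, i, hV, hb => by
    rw [decode, decode, decode_eq_of_testBit V cs (i + 1) (fun c' hc' => hV c' (List.mem_cons_of_mem _ hc'))
      (fun b hle => hb b (le_trans (Nat.mul_le_mul_right _ (Nat.le_succ i)) hle))]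
    congr 1
    exact List.filter_congr fun v _ => by rw [hb _ (Nat.le_add_right _ _)]

/-- Flipping a bit below `(i+1)·V` in column `i`'s block does not change the states of the columns
after `i`. [folklore] -/
private theorem decode_xor_succ (V key i v : ℕ) (hv : v < V) (cs : List Column)
    (hV : ∀ c ∈ cs, ∀ v ∈ c.vars, v < V) :
    decode V (key ^^^ 2 ^ (i * V + v)) cs (i + 1) = decode V key cs (i + 1) := by
  refine decode_eq_of_testBit V cs (i + 1) hV fun b hb => ?_
  rw [Nat.testBit_xor, Nat.testBit_two_pow]
  have : i * V + v ≠ b := by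
    intro h; subst h; rw [Nat.succ_mul] at hb; omega
  simp [this]

/-- Unused variables only read their own column's block. [folklore] -/
private theorem unusedVars_eq_of_testBit (V i : ℕ) {key₁ key₂ : ℕ} (vars : List ℕ) (hV : ∀ v ∈ vars, v < V)
    (hb : ∀ b, b < (i + 1) * V → key₁.testBit b = key₂.testBit b) :
    unusedVars V key₁ i vars = unusedVars V key₂ i vars := by
  refine List.filter_congr fun v hv => ?_
  rw [hb _ (by rw [Nat.succ_mul]; exact Nat.add_lt_add_left (hV v hv) _)]

/-- In a duplicate-free list, dropping from a filter its `j`-th element is filtering with that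
element switched off. [folklore] -/
private theorem filter_switch_off (p : ℕ → Bool) : ∀ (l : List ℕ), l.Nodup → ∀ (j : ℕ), j < (l.filter p).length →
    l.filter (fun v => xor (p v) (decide ((l.filter p).getD j 0 = v))) = (l.filter p).eraseIdx j
  | [], _, j, hj => by simp at hj
  | a :: l, hnd, j, hj => by
    have hal : a ∉ l := (List.nodup_cons.mp hnd).1
    have hnd' : l.Nodup := (List.nodup_cons.mp hnd).2
    by_cases hpa : p a = true
    · have hf : (a :: l).filter p = a :: l.filter p := by simp [hpa]
      rw [hf] at hj ⊢
      cases j with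
      | zero =>
        rw [List.getD_cons_zero, List.eraseIdx_cons_zero, List.filter_cons, if_neg (by simp [hpa])]
        refine List.filter_congr fun v hv => ?_
        have : a ≠ v := fun h => hal (h ▸ hv)
        simp [this]
      | succ j =>
        rw [List.getD_cons_succ, List.eraseIdx_cons_succ, List.filter_cons]
        have hj' : j < (l.filter p).length := by simpa using hj
        have hne : (l.filter p).getD j 0 ≠ a := by
          intro h
          apply hal
          rw [← h, List.getD_eq_getElem (hn := hj')]
          exact List.mem_of_mem_filter (List.getElem_mem hj')
        rw [if_pos (by rw [hpa, decide_eq_false hne]; rfl), filter_switch_off p l hnd' j hj']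
    · have hf : (a :: l).filter p = l.filter p := by simp [hpa]
      rw [hf] at hj ⊢
      rw [List.filter_cons]
      have hne : (l.filter p).getD j 0 ≠ a := by
        intro h
        apply hal
        rw [← h, List.getD_eq_getElem (hn := hj)]
        exact List.mem_of_mem_filter (List.getElem_mem hj)
      have hpa' : p a = false := by simpa using hpa
      rw [if_neg (by rw [hpa', decide_eq_false hne]; decide), filter_switch_off p l hnd' j hj]

/-- **Choosing the `j`-th unused variable clears exactly that variable.** [folklore] -/
private theorem unusedVars_xor (V key i : ℕ) (vars : List ℕ) (hnd : vars.Nodup) (j : ℕ) (hj : j < (unusedVars V key i vars).length) :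
    unusedVars V (key ^^^ 2 ^ (i * V + (unusedVars V key i vars).getD j 0)) i vars =
      (unusedVars V key i vars).eraseIdx j := by
  unfold unusedVars at hj ⊢
  rw [← filter_switch_off _ vars hnd j hj]
  refine List.filter_congr fun v _ => ?_
  rw [Nat.testBit_xor, Nat.testBit_two_pow]
  simp only [Nat.add_left_cancel_iff]

end Decode

/-! ## §2 One walk on a bit-set state is one walk of `walkA` on the decoded state -/

section Sim

variable {R : Type*} [CommRing R] [DecidableEq R]

omit [CommRing R] [DecidableEq R] in
/-- The candidate loop of one active column against `walkA`'s `flatMap` over the indices of the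
unused variables. [folklore] -/
private theorem choices_sim (V u i key : ℕ) (t : PTrie R) (c : Column) (cs : List Column)
    (hcV : ∀ v ∈ c.vars, v < V) (hcnd : c.vars.Nodup) (hV : ∀ c' ∈ cs, ∀ v ∈ c'.vars, v < V)
    (cont : ℕ → PTrie R → List (Bool × R × ℕ))
    (hrec : ∀ (key' : ℕ) (t' : PTrie R),
      (cont key' t').map (fun r => (r.1, r.2.1, decode V r.2.2 cs (i + 1))) =
          walkA (plan cs u) (decode V key' cs (i + 1)) t' ∧
        ∀ r ∈ cont key' t', ∀ b, b < (i + 1) * V → r.2.2.testBit b = key'.testBit b) :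
    ∀ (l : List ℕ) (j₀ : ℕ), (unusedVars V key i c.vars).drop j₀ = l →
      ((choicesB V key i t cont l j₀).map
          (fun r => (r.1, r.2.1, unusedVars V r.2.2 i c.vars :: decode V r.2.2 cs (i + 1))) =
        (List.range' j₀ l.length).flatMap fun j =>
          if (t.child ((unusedVars V key i c.vars).getD j 0)).isEmpty then []
          else (walkA (plan cs u) (decode V key cs (i + 1))
              (t.child ((unusedVars V key i c.vars).getD j 0))).map fun r =>
            (xor (decide (j % 2 = 1)) r.1, r.2.1, (unusedVars V key i c.vars).eraseIdx j :: r.2.2)) ∧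
      ∀ r ∈ choicesB V key i t cont l j₀, ∀ b, b < i * V → r.2.2.testBit b = key.testBit b
  | [], j₀, _ => by simp [choicesB]
  | v :: l, j₀, hd => by
    set us := unusedVars V key i c.vars with hus
    have hj₀ : j₀ < us.length := by
      by_contra h
      rw [List.drop_eq_nil_of_le (not_lt.mp h)] at hd
      exact List.cons_ne_nil _ _ hd.symm
    have hv : us.getD j₀ 0 = v := by
      rw [List.getD_eq_getElem (hn := hj₀), ← List.head_drop (h := by rw [hd]; simp)]
      simp [hd]
    have hd' : us.drop (j₀ + 1) = l := by
      rw [← List.drop_drop, hd]; rfl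
    have hvV : v < V := hcV v (by
      have : v ∈ us := by rw [← hv, List.getD_eq_getElem (hn := hj₀)]; exact List.getElem_mem hj₀
      exact List.mem_of_mem_filter this)
    obtain ⟨IH1, IH2⟩ := choices_sim V u i key t c cs hcV hcnd hV cont hrec l (j₀ + 1) hd'
    -- the recursive walk from the updated state
    obtain ⟨h1, h2⟩ := hrec (key ^^^ 2 ^ (i * V + v)) (t.child v)
    rw [decode_xor_succ V key i v hvV cs hV] at h1
    have hcol : ∀ r ∈ cont (key ^^^ 2 ^ (i * V + v)) (t.child v),
        unusedVars V r.2.2 i c.vars = us.eraseIdx j₀ := by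
      intro r hr
      rw [unusedVars_eq_of_testBit V i c.vars hcV (h2 r hr), ← hv]
      exact unusedVars_xor V key i c.vars hcnd j₀ hj₀
    refine ⟨?_, ?_⟩
    · rw [choicesB, List.map_append, IH1, List.length_cons, List.range'_succ, List.flatMap_cons, hv]
      congr 1
      split_ifs with he
      · rfl
      · rw [← h1, List.map_map, List.map_map]
        refine List.map_congr_left fun r hr => ?_
        simp only [Function.comp_apply, hcol r hr]
    · intro r hr b hb
      rw [choicesB, List.mem_append] at hr
      rcases hr with hr | hr
      · split_ifs at hr with he
        · simp at hr
        · rw [List.mem_map] at hr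
          obtain ⟨r', hr', rfl⟩ := hr
          have hb' : b < (i + 1) * V := lt_of_lt_of_le hb (Nat.mul_le_mul_right _ (Nat.le_succ i))
          rw [h2 r' hr' b hb', Nat.testBit_xor, Nat.testBit_two_pow]
          have : i * V + v ≠ b := by omega
          simp [this]
      · exact IH2 r hr b hb

omit [CommRing R] [DecidableEq R] in
/-- **Simulation**: mapping the outcomes of `walkB` through `decode` gives exactly the outcomes of
`walkA` on the decoded state, and the walk only touches the bits of its own columns. [folklore] -/
private theorem walkB_sim (V u : ℕ) : ∀ (cs : List Column) (i key : ℕ) (t : PTrie R),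
    (∀ c ∈ cs, ∀ v ∈ c.vars, v < V) → (∀ c ∈ cs, c.vars.Nodup) →
    ((walkB V (actPlan u cs i) key t).map (fun r => (r.1, r.2.1, decode V r.2.2 cs i)) =
        walkA (plan cs u) (decode V key cs i) t) ∧
      ∀ r ∈ walkB V (actPlan u cs i) key t, ∀ b, b < i * V → r.2.2.testBit b = key.testBit b
  | [], i, key, t, _, _ => by
    cases t <;> simp [actPlan, walkB, plan, decode, walkA]
  | c :: cs, i, key, t, hV, hnd => by
    have hcV : ∀ v ∈ c.vars, v < V := hV c List.mem_cons_self
    have hV' : ∀ c' ∈ cs, ∀ v ∈ c'.vars, v < V := fun c' h => hV c' (List.mem_cons_of_mem _ h)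
    have hnd' : ∀ c' ∈ cs, c'.vars.Nodup := fun c' h => hnd c' (List.mem_cons_of_mem _ h)
    have IH := fun key' t' => walkB_sim V u cs (i + 1) key' t' hV' hnd'
    rw [plan, List.map_cons, ← plan, decode]
    cases hel : c.labels.elem u with
    | false =>
      rw [actPlan, hel]
      simp only [Bool.false_eq_true, ↓reduceIte, walkA]
      obtain ⟨h1, h2⟩ := IH key t
      refine ⟨?_, fun r hr b hb => h2 r hr b (lt_of_lt_of_le hb (Nat.mul_le_mul_right _ (Nat.le_succ i)))⟩
      rw [← h1, List.map_map]
      refine List.map_congr_left fun r hr => ?_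
      rw [Function.comp_apply, decode, unusedVars_eq_of_testBit V i c.vars hcV (h2 r hr)]
    | true =>
      rw [actPlan, hel]
      simp only [↓reduceIte, walkA, walkB]
      obtain ⟨h1, h2⟩ := choices_sim V u i key t c cs hcV (hnd c List.mem_cons_self) hV'
        (fun key' t' => walkB V (actPlan u cs (i + 1)) key' t') IH (unusedVars V key i c.vars) 0 rfl
      refine ⟨?_, h2⟩
      simp only [decode]
      rw [h1, List.range_eq_range']

end Sim

/-! ## §3 The layers compute the specification; `evalB = evalC` -/

section Layers

variable {R : Type*} [CommRing R] [DecidableEq R]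

omit [DecidableEq R] in
/-- Pushing preserves weightings. [folklore] -/
private theorem sum_foldr_pushB (g : ℕ → R) :
    ∀ l : List (ℕ × R), ((l.foldr pushB []).map fun e => e.2 * g e.1).sum = (l.map fun e => e.2 * g e.1).sum
  | [] => rfl
  | a :: l => by
    have IH := sum_foldr_pushB g l
    rw [List.foldr_cons, List.map_cons, List.sum_cons, ← IH]
    cases hc : l.foldr pushB [] with
    | nil => simp [pushB]
    | cons b l' =>
      simp only [pushB]
      split_ifs with h
      · have h2 : a.1 = b.1 := by simpa using h
        simp only [List.map_cons, List.sum_cons, add_mul, h2, add_assoc]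
      · simp only [List.map_cons, List.sum_cons]

/-- **Compression preserves weightings**: for any `g` on states, `∑ v · g st` over `compressB l`
equals the same sum over `l` (equal states are added up, zero values dropped). [folklore] -/
private theorem sum_compressB (g : ℕ → R) (l : List (ℕ × R)) :
    ((compressB l).map fun e => e.2 * g e.1).sum = (l.map fun e => e.2 * g e.1).sum := by
  unfold compressB
  rw [← sum_foldr_pushB g l]
  generalize l.foldr pushB [] = L
  induction L with
  | nil => rfl
  | cons a L ih =>
    rw [List.filter_cons]
    split_ifs with h
    · rw [List.map_cons, List.sum_cons, List.map_cons, List.sum_cons, ih]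
    · have h0 : a.2 = 0 := by simpa using h
      rw [List.map_cons, List.sum_cons, ih, h0, zero_mul, zero_add]

/-- The meaning of a bit-set layer at label `u`: values times the specification on the labels
`[u, …, u + n - 1]` of the residual columns of the decoded states. [folklore] -/
def layerSpecB (S : List ℕ → R) (cols : List Column) (V u n : ℕ) (L : List (ℕ × R)) : R :=
  (L.map fun e => e.2 * specL S (List.range' u n) (resid cols (decode V e.1 cols 0) u)).sum

omit [DecidableEq R] in
/-- `layerSpecB` is invariant under permutations of the layer. [folklore] -/
private theorem layerSpecB_perm (S : List ℕ → R) (cols : List Column) (V u n : ℕ)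
    {L L' : List (ℕ × R)} (h : L.Perm L') : layerSpecB S cols V u n L = layerSpecB S cols V u n L' :=
  (h.map _).sum_eq

/-- **One bit-set layer step preserves the meaning.** [folklore] -/
private theorem layerSpecB_stepB (V : ℕ) (T : PTrie R) (cols : List Column)
    (hcs : ∀ c ∈ cols, c.labels.Pairwise (· < ·)) (hV : ∀ c ∈ cols, ∀ v ∈ c.vars, v < V)
    (hnd : ∀ c ∈ cols, c.vars.Nodup) (u n : ℕ) (L : List (ℕ × R)) :
    layerSpecB (fun w => T.find w) cols V (u + 1) n (stepB cols V T u L) =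
      layerSpecB (fun w => T.find w) cols V u (n + 1) L := by
  unfold stepB layerSpecB
  refine Eq.trans (sum_compressB (fun st => specL (fun w => T.find w)
    (List.range' (u + 1) n) (resid cols (decode V st cols 0) (u + 1))) _) ?_
  rw [((msortK_perm _ _).map _).sum_eq]
  unfold expandB
  rw [sum_map_flatMap]
  refine congrArg List.sum (List.map_congr_left fun e _ => ?_)
  rw [List.map_map, List.range'_succ, specL]
  obtain ⟨h1, -⟩ := walkB_sim (R := R) V u cols 0 e.1 T hV hnd
  -- transport along the simulation, then along `walkA = walkL`
  have hw := sum_walkA (M := R) u cols (decode V e.1 cols 0) T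
    (fun b a st' => smul3 b e.2 a * specL (fun w => T.find w) (List.range' (u + 1) n) (resid cols st' (u + 1)))
    hcs (length_decode V e.1 cols 0) (fun b s => by simp [smul3])
  rw [← h1, List.map_map] at hw
  simp only [Function.comp_def] at hw ⊢
  rw [hw, ← List.sum_map_mul_left]
  refine congrArg List.sum (List.map_congr_left fun o ho => ?_)
  rw [← resid_of_mem_walkL u cols (decode V e.1 cols 0) o hcs (length_decode V e.1 cols 0) ho]
  have key : ∀ (b : Bool) (v a X : R), smul3 b v a * X = v * (sgn b * a * X) := by
    intro b v a X; cases b <;> simp [smul3, sgn] <;> ring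
  exact key _ _ _ _

/-- **The bit-set layers compute the meaning.** [folklore] -/
private theorem layerSum_layersB (V : ℕ) (T : PTrie R) (cols : List Column)
    (hcs : ∀ c ∈ cols, c.labels.Pairwise (· < ·)) (hV : ∀ c ∈ cols, ∀ v ∈ c.vars, v < V)
    (hnd : ∀ c ∈ cols, c.vars.Nodup) :
    ∀ (n u : ℕ) (L : List (ℕ × R)),
      layerSumB (layersB cols V T (List.range' u n) L) = layerSpecB (fun w => T.find w) cols V u n L
  | 0, u, L => by simp [layersB, layerSumB, layerSpecB, specL]
  | n + 1, u, L => by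
    rw [List.range'_succ, layersB, layerSum_layersB V T cols hcs hV hnd n (u + 1),
      layerSpecB_stepB V T cols hcs hV hnd u n L]

/-- Layers along a concatenated label list are layers along the second from the layers along the
first (the chunking interface of certificate modules). [cite: DorflerIkenmeyerPanova2020, §5] -/
theorem layersB_append (cols : List Column) (V : ℕ) (T : PTrie R) :
    ∀ (l₁ l₂ : List ℕ) (L : List (ℕ × R)),
      layersB cols V T (l₁ ++ l₂) L = layersB cols V T l₂ (layersB cols V T l₁ L)
  | [], _, _ => rfl
  | u :: l₁, l₂, L => by rw [List.cons_append, layersB, layersB, layersB_append cols V T l₁ l₂]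

/-- The bits of one column's initial block sit below the next block. [folklore] -/
private theorem testBit_foldr_or_of_ge (V i : ℕ) : ∀ (vars : List ℕ), (∀ v ∈ vars, v < V) →
    ∀ b, (i + 1) * V ≤ b → (vars.foldr (fun v acc => acc ||| 2 ^ (i * V + v)) 0).testBit b = false
  | [], _, b, _ => by simp
  | v :: vars, hV, b, hb => by
    rw [List.foldr_cons, Nat.testBit_or, testBit_foldr_or_of_ge V i vars
      (fun w hw => hV w (List.mem_cons_of_mem _ hw)) b hb, Nat.testBit_two_pow]
    have : i * V + v ≠ b := by
      have := hV v List.mem_cons_self; rw [Nat.succ_mul] at hb; omega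
    simp [this]

/-- Every variable of a column is set in its initial block. [folklore] -/
private theorem testBit_foldr_or_self (V i : ℕ) : ∀ (vars : List ℕ) (v : ℕ), v ∈ vars →
    (vars.foldr (fun v acc => acc ||| 2 ^ (i * V + v)) 0).testBit (i * V + v) = true
  | [], v, hv => by simp at hv
  | w :: vars, v, hv => by
    rw [List.foldr_cons, Nat.testBit_or]
    rcases List.mem_cons.mp hv with rfl | hv
    · simp
    · rw [testBit_foldr_or_self V i vars v hv, Bool.true_or]

/-- **The initial state decodes to all variables unused.** [folklore] -/
private theorem decode_initKey (V : ℕ) : ∀ (cols : List Column) (i : ℕ), (∀ c ∈ cols, ∀ v ∈ c.vars, v < V) →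
    decode V (initKey V cols i) cols i = cols.map Column.vars
  | [], _, _ => rfl
  | c :: cols, i, hV => by
    have hcV : ∀ v ∈ c.vars, v < V := hV c List.mem_cons_self
    have hV' : ∀ c' ∈ cols, ∀ v ∈ c'.vars, v < V := fun c' h => hV c' (List.mem_cons_of_mem _ h)
    rw [decode, initKey, List.map_cons]
    congr 1
    · unfold unusedVars
      refine List.filter_eq_self.mpr fun v hv => ?_
      rw [Nat.testBit_or, testBit_foldr_or_self V i c.vars v hv, Bool.true_or]
    · rw [← decode_initKey V cols (i + 1) hV']
      refine decode_eq_of_testBit V cols (i + 1) hV' fun b hb => ?_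
      rw [Nat.testBit_or, testBit_foldr_or_of_ge V i c.vars hcV b hb, Bool.false_or]

/-- **The bit-set programme computes the specification** (with the polarisation trie's entries as
entry function). [cite: DorflerIkenmeyerPanova2020, §5] -/
theorem evalB_eq_specL (P : Point R) (N : Network) (hcs : N.columnStrict = true)
    (hnd : ∀ c ∈ N.cols, c.vars.Nodup) :
    evalB P N = specL (fun w => (trieD N.varBound N.perLabel P).find w) (List.range N.nlabels) N.cols := by
  have hV : ∀ c ∈ N.cols, ∀ v ∈ c.vars, v < N.varBound := fun c hc v hv => lt_varBound N c hc v hv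
  unfold evalB
  rw [List.range_eq_range', layerSum_layersB N.varBound _ N.cols (pairwise_of_columnStrict N hcs) hV hnd
    N.nlabels 0]
  simp [layerSpecB, decode_initKey N.varBound N.cols 0 hV, resid_zero]

/-- Alternator variable lists of a network passing its structural check are duplicate-free.
[folklore] -/
private theorem nodup_vars_of_check (N : Network) (hN : N.check = true) : ∀ c ∈ N.cols, c.vars.Nodup := by
  unfold Network.check at hN
  simp only [Bool.and_eq_true, List.all_eq_true, decide_eq_true_eq] at hN
  exact fun c hc => (hN.1.1.1 c hc).2

/-- **The bit-set programme with the polarisation trie computes the column-major evaluator**: for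
a list point all of whose terms have `m` forms and a column-strict network passing its structural
check, `evalB P N = evalC P N`. [cite: DorflerIkenmeyerPanova2020, §5] -/
theorem evalB_eq_evalC (P : Point R) (N : Network)
    (hP : ∀ t : Fin P.terms.length, (P.terms.get t).2.length = N.perLabel)
    (hN : N.check = true) (hcs : N.columnStrict = true) : evalB P N = evalC P N := by
  obtain ⟨hlen, hlab, hcnt⟩ := Network.spec_of_check N hN
  have hV : 0 < N.varBound := Nat.succ_pos _
  let E := finEnum N.varBound hV
  have hP' : ∀ t ∈ P.terms, t.2.length = N.perLabel := fun t ht => by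
    obtain ⟨i, rfl⟩ := List.mem_iff_get.mp ht; exact hP i
  rw [evalB_eq_specL P N hcs (nodup_vars_of_check N hN)]
  refine specL_eq_evalC E P N hP hlen (fun c hc v hv => lt_varBound N c hc v hv) hlab hcnt hcs _
    fun w hw hv => ?_
  rw [← symEntry_eq_S E P hP w hw hv, find_trieD N.varBound N.perLabel P w hP' hw hv]

end Layers

/-! ## §4 Splitting a layer (sub-label chunking interface of certificate modules) -/

section Split

variable {R : Type*} [CommRing R] [DecidableEq R]

/-- **Splitting a layer splits the final sum**: for a column-strict network passing its structural
check, running the remaining labels `u, …, u + n - 1` on a concatenated layer `L₁ ++ L₂` and summing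
gives the sum of the two separate runs (the layers' meaning `layerSpecB` is additive in the layer) —
so a certificate module may cut an over-long layer into pieces and add the pieces' results, each
piece being one kernel declaration. [cite: DorflerIkenmeyerPanova2020, §5] -/
theorem layerSumB_layersB_append_layer (T : PTrie R) (N : Network) (hN : N.check = true)
    (hcs : N.columnStrict = true) (u n : ℕ) (L₁ L₂ : List (ℕ × R)) :
    layerSumB (layersB N.cols N.varBound T (List.range' u n) (L₁ ++ L₂)) =
      layerSumB (layersB N.cols N.varBound T (List.range' u n) L₁) +
        layerSumB (layersB N.cols N.varBound T (List.range' u n) L₂) := by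
  have hV : ∀ c ∈ N.cols, ∀ v ∈ c.vars, v < N.varBound := fun c hc v hv => lt_varBound N c hc v hv
  have hnd := nodup_vars_of_check N hN
  have hpw := pairwise_of_columnStrict N hcs
  rw [layerSum_layersB N.varBound T N.cols hpw hV hnd n u (L₁ ++ L₂),
    layerSum_layersB N.varBound T N.cols hpw hV hnd n u L₁,
    layerSum_layersB N.varBound T N.cols hpw hV hnd n u L₂]
  unfold layerSpecB
  rw [List.map_append, List.sum_append]

end Split

end TableauEval

end Literature.Computability.AlgebraicComplexity
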